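import Literature.Probability.Percolation.ArmSeparationMove
import Literature.Probability.Percolation.ArmSeparationOutMoveFour
import Literature.Probability.Percolation.ArmSeparationExtFourArmQ
import HarnessLib

/-!
# The inner landing moves for four arms: arbitrary target row, outer end on any box side, target side `0` or `2`

Topic `Literature/Probability/Percolation`; family `crit-perc` / near-critical percolation on `𝕋`.
A brick of the near-critical arm-separation theorem for four arms of alternating colours
(P. Nolin, *Near-critical percolation in two dimensions*, EJP 13 (2008), Thm. 11 for `j = 4`,
`σ = BWBW` [arXiv 0711.4948: Thm. 10], landing step of the INTERNAL extremities, §4.4 p. 13 with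
Prop. 12 (i) [arXiv Prop. 11]; H. Kesten, CMP 109 (1987), Lemma 2). The tree's inner landing move
`landing_move` (`ArmSeparationMove.lean`) carries ONE tiny-fenced inner tip through beacon, spoke,
ring arc, approach tube and target free space to a landing on the RIGHT side of `∂Λ_n` at one of
two fixed target rows, for an arm whose outer end is landed on the right side of `∂Λ_N`. For four
arms landing inside on the sides `0, 2, 3, 5` while already landed outside on the sides
`0, 2, 3, 5`, three generalisations are needed, proved here:

* the outer end on ANY box-preserving side `q` (`sepArmGen n N q`: inner free space on the right
  side of `∂Λ_n`, outer free space on the side `q` of `∂Λ_N`, read in `frameConfig q`; for `q = 0`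
  this is `sepOpenArm n N`, `sepArmGen_zero`), with the gluing `landing_glue_gen`;
* an arbitrary target row `t` of the inner landing zone (`landing_move_gen`);
* landing on the TOP side `2` (`landing_move_gen_two`, through the transposition `frameIso 2 = σ` of
  tubes, chains and crossings, `Tube.swap`, as in `ArmSeparationOutMoveFour.lean`): the conclusion is
  `frameConfig 2 χ ∈ sepArmGen n N q₂` for the frame `q₂` with `frameIso q₂ = σ ∘ frameIso q`.

Everything here is proved; no named facts are introduced.

## References

* P. Nolin, Near-critical percolation in two dimensions, *Electron. J. Probab.* 13 (2008), §4.2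
  Def. 6–8, §4.3 Prop. 12, §4.4 (arXiv 0711.4948: Def. 6–8, Prop. 11, proof of Thm. 10, p. 13) [Nolin2008].
* H. Kesten, Scaling relations for 2D-percolation, *Comm. Math. Phys.* 109 (1987), Lemma 2 [Kesten1987].

Tree: `landing_glue`, `tgtH`, `tgtV`, `tgtVStrip_subset_sepInnerFence`, `vchunks_eq_cons`
(`ArmSeparationLandingGlue.lean`); `landing_move`, `norm_mem_of_mem_spokeBox`,
`norm_mem_of_mem_tipBox'` (`ArmSeparationMove.lean`); `arm_to_entry` (`ArmSeparationSpoke.lean`);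
`Tube.swap` and its API (`ArmSeparationOutMoveFour.lean`); `frameIso`, `frameConfig`.
-/

noncomputable section

open Set

namespace Literature.Probability.Percolation

open LatticeModels HalfAnnulus Tube

/-! ### The arm region of a landed arm, framed -/

/-- The arm region of a landed arm with landing site `z`: the annulus and the landing ball. [cite: Nolin2008, §4.2 Def. 6 (arXiv 0711.4948)] -/
def armRegion (m N : ℕ) (z : Site 2) : Set (Site 2) := triAnnulusSet m N ∪ triOpenBall z (N / 8)

/-- The framed arm region consists of sites of norm in `[m, N + N/8]` (`2m ≤ N`, `s < 6`). [folklore] -/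
theorem norm_mem_frame_armRegion {m N s : ℕ} (hs : s < 6) (hN : 2 * m ≤ N) {z : Site 2} (hz : z ∈ sepLanding N) :
    ∀ v ∈ frameIso s '' armRegion m N z, (m : ℤ) ≤ triNorm v ∧ triNorm v ≤ ((N + N / 8 : ℕ) : ℤ) := by
  rintro _ ⟨v, hv, rfl⟩
  rw [show ((frameIso s : triGraph ≃g triGraph) v) = frameIso s v from rfl, triNorm_frameIso s hs]
  refine ⟨norm_le_of_mem_extRegion hN hz v hv, ?_⟩
  rw [mem_sepLanding] at hz
  have h4 : 4 * (((N / 4 : ℕ) : ℤ)) ≤ N := by exact_mod_cast Nat.mul_div_le N 4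
  rcases hv with hv | hv
  · have := (mem_triAnnulusSet.1 hv).2; push_cast; omega
  · rw [mem_triOpenBall, triNorm_lt_iff_lin] at hv
    simp only [Pi.sub_apply] at hv
    push_cast
    exact triNorm_le_iff_lin.2 (by omega)

/-- The framed arm region contains the annulus `{m ≤ |v| ≤ 2m}` (`2m ≤ N`, `s < 6`). [folklore] -/
theorem triAnnSet_subset_frame_armRegion {m N s : ℕ} (hs : s < 6) (hN : 2 * m ≤ N) (z : Site 2) :
    triAnnSet m (2 * m) ⊆ frameIso s '' armRegion m N z := by
  intro v hv
  refine ⟨(frameIso s).symm v, triAnnSet_subset_extRegion hN z ?_, (frameIso s).apply_symm_apply v⟩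
  rw [mem_triAnnSet] at hv ⊢
  rw [show ((frameIso s).symm : triGraph ≃g triGraph) v = (frameIso s).symm v from rfl, triNorm_frameIso_symm s hs]
  exact hv

/-! ### The landed arm with outer end on the side `q` -/

/-- **An open arm landed inside on the right side of `∂Λ_n` and outside on the side `q` of
`∂Λ_N`** (the single-arm form of Nolin's `Ã̃^{η,I/η',I'}` for arms whose two landing sides
differ by a box-preserving frame): inner free space at `z ∈ sepLanding n` crossed through `u`,
outer free space at `zo ∈ sepLanding N` of the side `q` — read in `frameConfig q` — crossed through
`uo`, and an open path of the annulus and the two attaching balls from `u` to `frameIso q uo`. [cite: Nolin2008, §4.2 Def. 6–8 (arXiv 0711.4948: Def. 6–8)] -/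
def sepArmGen (n N q : ℕ) : Set (SiteConfig (Site 2)) :=
  {χ | ∃ z zo u uo : Site 2, z ∈ sepLanding n ∧ zo ∈ sepLanding N ∧
    OpenVCrossThrough (sepInnerFence n z) (z 1 - (n / 64 : ℕ)) (z 1 + (n / 64 : ℕ)) χ u ∧
    OpenVCrossThrough (sepOuterFence N zo) (zo 1 - (N / 64 : ℕ)) (zo 1 + (N / 64 : ℕ)) (frameConfig q χ) uo ∧
    PathIn triGraph ((triAnnulusSet n N ∪ frameIso q '' triOpenBall zo (N / 8) ∪ triOpenBall z (n / 8)) ∩ χ) u (frameIso q uo)}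

/-- For `q = 0` the landed arm is the tree's `sepOpenArm`. [folklore] -/
theorem sepArmGen_zero (n N : ℕ) : sepArmGen n N 0 = sepOpenArm n N := by
  ext χ
  have h0 : frameConfig 0 χ = χ := by ext v; rw [mem_frameConfig]; rfl
  have himg : ∀ S : Set (Site 2), (frameIso 0 : triGraph ≃g triGraph) '' S = S := fun S => by
    ext v; constructor
    · rintro ⟨w, hw, rfl⟩; exact hw
    · intro hv; exact ⟨v, hv, rfl⟩
  constructor
  · rintro ⟨z, zo, u, uo, hz, hzo, hin, hout, hp⟩
    rw [h0] at hout
    rw [himg] at hp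
    exact ⟨zo, z, u, uo, hzo, hz, hin, hout, hp⟩
  · rintro ⟨zo, z, u, uo, hzo, hz, hin, hout, hp⟩
    refine ⟨z, zo, u, uo, hz, hzo, hin, by rw [h0]; exact hout, ?_⟩
    rw [himg]; exact hp

/-- The arm region of the generalised landed arm. [folklore] -/
def genRegion (n N q : ℕ) (zo z : Site 2) : Set (Site 2) :=
  triAnnulusSet n N ∪ frameIso q '' triOpenBall zo (N / 8) ∪ triOpenBall z (n / 8)

/-- The approach tube lies in the generalised arm region (as `tgtHStrip_subset_sepJoinRegion`). [cite: Nolin2008, §4.2 Def. 6–7 (arXiv 0711.4948)] -/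
theorem tgtHStrip_subset_genRegion {n N W q : ℕ} (hn : 64 ≤ n) (hnN : n ≤ N) (hW : (n : ℤ) - (n / 8 : ℕ) + 1 + W ≤ N)
    {t : ℤ} (ht : -(n : ℤ) + (n / 4 : ℕ) ≤ t ∧ t ≤ -((n / 4 : ℕ) : ℤ)) (zo : Site 2) :
    triStrip ((n : ℤ) - (n / 8 : ℕ) + 1) t W (n / 64) ⊆ genRegion n N q zo ![(n : ℤ), t] := by
  intro v hv
  rcases tgtHStrip_subset_sepJoinRegion hn hnN hW ht zo hv with (h | h) | h
  · exact Or.inl (Or.inl h)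
  · -- does not happen, but harmless: re-derive from the strip
    rw [mem_triStrip] at hv
    have hnN' : (n : ℤ) ≤ N := by exact_mod_cast hnN
    rcases le_or_gt (n : ℤ) (v 0) with h0 | h0
    · exact Or.inl (Or.inl ⟨le_triNorm_iff_lin.2 (Or.inl h0), triNorm_le_iff_lin.2 (by omega)⟩)
    · refine Or.inr ?_
      rw [mem_triOpenBall, triNorm_lt_iff_lin]
      simp only [Pi.sub_apply, site_mk_apply_zero, site_mk_apply_one]
      omega
  · exact Or.inr h

/-- **Landing glue, outer end on the side `q`.** As the tree's `landing_glue`, with the outer free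
space of the side `q` (read in `frameConfig q χ`, attaching site `frameIso q uo`) and the arm region
`genRegion n N q zo (n, t)`; conclusion `χ ∈ sepArmGen n N q`. [cite: Nolin2008, §4.3 Prop. 12 (proof) (arXiv 0711.4948: Prop. 11)] -/
theorem landing_glue_gen {n N q : ℕ} {χ : SiteConfig (Site 2)} {zo uo : Site 2} (hzo : zo ∈ sepLanding N)
    (hOut : OpenVCrossThrough (sepOuterFence N zo) (zo 1 - (N / 64 : ℕ)) (zo 1 + (N / 64 : ℕ)) (frameConfig q χ) uo)
    {t : ℤ} (ht : (![(n : ℤ), t] : Site 2) ∈ sepLanding n)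
    {E : Tube} {L : List Tube} (hch : List.IsChain Crosses (E :: L)) {X Y : Tube → Site 2}
    (hXY : ∀ T ∈ E :: L, T.IsCrossing χ (X T) (Y T)) (hLreg : ∀ T ∈ E :: L, T.box ⊆ triAnnulusSet n N)
    {R₁ : Set (Site 2)} (hR₁ : R₁ ⊆ genRegion n N q zo ![(n : ℤ), t]) {Te : Tube} (hTe : Te ∈ E :: L)
    (P₁ : PathIn triGraph (R₁ ∩ χ) (frameIso q uo) (X Te)) {r e s j₀ d : ℕ} (hSL : ∀ T ∈ vchunks r (-(r : ℤ)) e s j₀ (d + 1), T ∈ E :: L)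
    (hlo : -(r : ℤ) + j₀ * s - e ≤ t) (hhi : t + (n / 64 : ℕ) ≤ -(r : ℤ) + (j₀ + d) * s - e)
    (hre : (n : ℤ) ≤ (r : ℤ) - e) {W : ℕ} (hW : (n : ℤ) - (n / 8 : ℕ) + 1 + W = r + 2 * e)
    (hH : χ ∈ tgtH n t W) (hV : χ ∈ tgtV n t) (hn : 64 ≤ n) (hrN : (r : ℤ) + 2 * e ≤ N) :
    χ ∈ sepArmGen n N q := by
  have htr := (mem_sepLanding.1 ht)
  rw [site_mk_apply_zero, site_mk_apply_one] at htr
  have h8 : ((n / 8 - 2 : ℕ) : ℤ) = (n / 8 : ℕ) - 2 := by omega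
  -- (1) the target free space and the approach tube
  obtain ⟨bb, tt, hbb, htt, PF⟩ := hV
  obtain ⟨SF, hSF, PF', TF⟩ := PF.exists_support
  obtain ⟨hl, hr, hhl, hhr, PH⟩ := hH
  obtain ⟨SH, hSH, PH', TH⟩ := PH.exists_support
  have hSFb : ∀ z ∈ SF, (n : ℤ) - (n / 8 : ℕ) + 1 ≤ z 0 ∧ z 0 ≤ (n : ℤ) - 1 := fun z hz => by
    have := (hSF hz).1; rw [mem_triStrip, h8] at this; omega
  have hSHb : ∀ z ∈ SH, t ≤ z 1 ∧ z 1 ≤ t + (n / 64 : ℕ) := fun z hz => by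
    have := (hSH hz).1; rw [mem_triStrip] at this; omega
  obtain ⟨u, huH, huF⟩ := exists_mem_of_cross (L := (n : ℤ) - (n / 8 : ℕ) + 1) (R := (n : ℤ) - 1)
    (B := t - (n / 64 : ℕ)) (T := t + (n / 64 : ℕ)) (by omega) (by omega)
    PH' (by omega) (by omega) (fun z hz _ _ => by have := hSHb z hz; omega)
    PF' (by omega) (by rw [htt]; push_cast; ring_nf; omega) (fun z hz _ _ => hSFb z hz)
  have inner : OpenVCrossThrough (sepInnerFence n ![(n : ℤ), t]) ((![(n : ℤ), t] : Site 2) 1 - (n / 64 : ℕ))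
      ((![(n : ℤ), t] : Site 2) 1 + (n / 64 : ℕ)) χ u := by
    have hsub : SF ⊆ sepInnerFence n ![(n : ℤ), t] ∩ χ := fun z hz =>
      ⟨tgtVStrip_subset_sepInnerFence (by omega) t (hSF hz).1, (hSF hz).2⟩
    refine ⟨bb, tt, ?_, ?_, (TF u huF).mono hsub, ((TF u huF).symm.trans (TF tt PF'.right_mem)).mono hsub⟩
    · rw [site_mk_apply_one, hbb]
    · rw [site_mk_apply_one, htt]; push_cast; ring
  -- (2) the exit run, read with the prescribed crossings
  obtain ⟨L₀, hL₀⟩ := vchunks_eq_cons (r : ℤ) (-(r : ℤ)) e s j₀ d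
  have hchSL : List.IsChain Crosses (vPiece r (-(r : ℤ)) e s j₀ :: L₀) := hL₀ ▸ isChain_vchunks _ _ e s j₀ (d + 1)
  have hmemSL : ∀ T ∈ vPiece r (-(r : ℤ)) e s j₀ :: L₀, T ∈ vchunks r (-(r : ℤ)) e s j₀ (d + 1) := fun T hT => hL₀ ▸ hT
  have runs := chain_paths' X Y (vPiece r (-(r : ℤ)) e s j₀) L₀ hchSL (fun T hT => hXY T (hSL T (hmemSL T hT)))
  have hlast : vPiece r (-(r : ℤ)) e s (j₀ + d) ∈ vPiece r (-(r : ℤ)) e s j₀ :: L₀ := by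
    rw [← hL₀]; exact List.mem_of_mem_getLast? (by rw [getLast?_vchunks]; rfl)
  have PV := runs _ hlast
  obtain ⟨SV, hSV, PV', TV⟩ := PV.exists_support
  have hX0 : X (vPiece r (-(r : ℤ)) e s j₀) 1 = -(r : ℤ) + j₀ * s - e := by
    have := (hXY _ (hSL _ (hmemSL _ List.mem_cons_self))).1
    exact this.1.trans (by simp only [vPiece])
  have hX1 : X (vPiece r (-(r : ℤ)) e s (j₀ + d)) 1 = -(r : ℤ) + (j₀ + d) * s - e := by
    have := (hXY _ (hSL _ (hmemSL _ hlast))).1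
    exact this.1.trans (by simp only [vPiece, Nat.cast_add])
  have hSVb : ∀ z ∈ SV, (r : ℤ) - e ≤ z 0 ∧ z 0 ≤ (r : ℤ) + e := fun z hz => by
    obtain ⟨⟨T, hT, hzT⟩, -⟩ := hSV hz
    have := bounds_of_mem_vchunks (r : ℤ) (-(r : ℤ)) e s (hmemSL T hT) hzT
    exact ⟨this.1, this.2.1⟩
  obtain ⟨v, hvH, hvV⟩ := exists_mem_of_cross (L := (r : ℤ) - e) (R := (r : ℤ) + e) (B := t) (T := t + (n / 64 : ℕ))
    (by omega) (by omega) PH' (by omega) (by rw [hhr]; omega) (fun z hz _ _ => hSHb z hz)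
    PV' (by rw [hX0]; exact hlo) (by rw [hX1]; exact hhi) (fun z hz _ _ => hSVb z hz)
  -- (3) along the arc to the entry tube, then to the arm
  have PA := (chain_paths' X Y E L hch hXY Te hTe).symm.trans (chain_paths' X Y E L hch hXY _ (hSL _ (hmemSL _ List.mem_cons_self)))
  -- (4) assemble inside the arm region
  set R : Set (Site 2) := genRegion n N q zo ![(n : ℤ), t] with hR
  have hHreg : SH ⊆ R ∩ χ := fun z hz =>
    ⟨tgtHStrip_subset_genRegion hn (by omega) (by omega) ⟨by omega, by omega⟩ zo (hSH hz).1, (hSH hz).2⟩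
  have hann : triAnnulusSet n N ⊆ R := fun z hz => Or.inl (Or.inl hz)
  have hVreg : SV ⊆ R ∩ χ := fun z hz => by
    obtain ⟨⟨T, hT, hzT⟩, hzχ⟩ := hSV hz
    exact ⟨hann (hLreg T (hSL T (hmemSL T hT)) hzT), hzχ⟩
  have hAreg : boxAll (E :: L) ∩ χ ⊆ R ∩ χ := by
    rintro z ⟨⟨T, hT, hzT⟩, hzχ⟩; exact ⟨hann (hLreg T hT hzT), hzχ⟩
  have Q1 : PathIn triGraph (R ∩ χ) u hl := (TH u huH).symm.mono hHreg
  have Q2 : PathIn triGraph (R ∩ χ) hl v := (TH v hvH).mono hHreg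
  have Q3 : PathIn triGraph (R ∩ χ) v (X (vPiece r (-(r : ℤ)) e s j₀)) := (TV v hvV).symm.mono hVreg
  have Q4 : PathIn triGraph (R ∩ χ) (X (vPiece r (-(r : ℤ)) e s j₀)) (X Te) := PA.symm.mono hAreg
  have Q5 : PathIn triGraph (R ∩ χ) (X Te) (frameIso q uo) := P₁.symm.mono fun z hz => ⟨hR₁ hz.1, hz.2⟩
  exact ⟨![(n : ℤ), t], zo, u, uo, ht, hzo, inner, hOut, (((Q1.trans Q2).trans Q3).trans Q4).trans Q5⟩

/-! ### The move to the right side, at an arbitrary row, outer end on the side `q` -/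

/-- The middle-half target rows of the right side of `∂Λ_n` used by the four-arm landing are
landing rows: for `-n + n/4 + n/16 ≤ t ≤ -n/4 - n/16` (`16 ≤ n`), `(n, t) ∈ sepLanding n`. [cite: Nolin2008, §4.2 Def. 8 (arXiv 0711.4948)] -/
theorem inTgtRow_mem_sepLanding {n : ℕ} {t : ℤ}
    (ht : -(n : ℤ) + (n / 4 : ℕ) + (n / 16 : ℕ) ≤ t ∧ t ≤ -((n / 4 : ℕ) : ℤ) - (n / 16 : ℕ)) :
    (![(n : ℤ), t] : Site 2) ∈ sepLanding n := by
  rw [mem_sepLanding, site_mk_apply_zero, site_mk_apply_one]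
  exact ⟨rfl, by omega, by omega⟩

/-- **The inner landing move to the right side at an arbitrary middle target row, outer end on the
side `q`.** As the tree's `landing_move` (fenced inner arm `Fo` of `χ` in the frame `i`, tip row in
the window `[T₀, T₀ + w)`; beacon, spoke, an arc of the thin ring of radius `r` all crossed and
containing a tube met by the spoke and the run `V_{j₀}, …, V_{j₀+d}` across the rows
`[t, t + n/64]`; approach tube and thinned target free space at the row `t` crossed; size
conditions), for an arm whose outer end is landed on the side `q < 6` (arm region
`(frameIso i)⁻¹ (frameIso q (annulus ∪ landing ball))`, far end `(frameIso i)⁻¹ (frameIso q uo)`), and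
any target row `t` with `-n + n/4 + n/16 ≤ t ≤ -n/4 - n/16`. Then `χ ∈ sepArmGen n N q`. [cite: Nolin2008, §4.3 Prop. 12 and §4.4 (arXiv 0711.4948: Prop. 11, Thm. 10, p. 13)] -/
theorem landing_move_gen {m n N k₀ K R₀ q : ℕ} (hq : q < 6) {i : ℕ} (hi : i < 6) {χ : SiteConfig (Site 2)} {zo uo : Site 2}
    (hzo : zo ∈ sepLanding N)
    (hOut : OpenVCrossThrough (sepOuterFence N zo) (zo 1 - (N / 64 : ℕ)) (zo 1 + (N / 64 : ℕ)) (frameConfig q χ) uo)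
    (Fo : IntFencedArm m ((frameIso i).symm '' (frameIso q '' armRegion m N zo)) k₀ K R₀ (frameConfig i χ))
    (hb : Fo.b = (frameIso i).symm (frameIso q uo))
    {T₀ : ℤ} {w : ℕ} (hwk : 4 * w ≤ Fo.k) (hk : 4 ≤ Fo.k) (hwin : T₀ ≤ Fo.z 1 ∧ Fo.z 1 < T₀ + w)
    (hB : frameConfig i χ ∈ triFrameAt (bcnCentre m Fo.k T₀ w) (Fo.k / 2))
    {L ε : ℕ} (hε : 4 * ε ≤ Fo.k) (hL : 2 * Fo.k ≤ L) (hSp : χ ∈ spokeEvent i m Fo.k T₀ w L ε)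
    {r e s a len : ℕ} (hs : 1 ≤ s) (hsr : s ∣ r) (hsr' : s ≤ r) (he : 2 * e ≤ r)
    (harc : χ ∈ eventAll (arc (thinRing r e s) a len))
    {Te : Tube} (hTe : Te ∈ arc (thinRing r e s) a len) (hJ : SpokeMeets i (spokeTube m Fo.k T₀ w L ε) Te)
    {t : ℤ} (ht : -(n : ℤ) + (n / 4 : ℕ) + (n / 16 : ℕ) ≤ t ∧ t ≤ -((n / 4 : ℕ) : ℤ) - (n / 16 : ℕ))
    {j₀ d : ℕ} (hSL : ∀ T ∈ vchunks r (-(r : ℤ)) e s j₀ (d + 1), T ∈ arc (thinRing r e s) a len)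
    (hlo : -(r : ℤ) + j₀ * s - e ≤ t) (hhi : t + (n / 64 : ℕ) ≤ -(r : ℤ) + (j₀ + d) * s - e)
    {W : ℕ} (hW : (n : ℤ) - (n / 8 : ℕ) + 1 + W = r + 2 * e) (hH : χ ∈ tgtH n t W)
    (hV : χ ∈ tgtV n t)
    (hn : 64 ≤ n) (hnr : (n : ℤ) + s + 2 * e ≤ r) (hrm : (r : ℤ) + 2 * e ≤ m) (hmN : 2 * m ≤ N)
    (hnL : (n : ℤ) + 2 * Fo.k + L ≤ m + 1) (hn5 : (n : ℤ) + 5 * Fo.k ≤ m) (hR : 4 * Fo.k ≤ R₀) :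
    χ ∈ sepArmGen n N q := by
  have hmN' : 2 * (m : ℤ) ≤ N := by exact_mod_cast hmN
  have hR' : 4 * (Fo.k : ℤ) ≤ R₀ := by exact_mod_cast hR
  have hwk' : 4 * (w : ℤ) ≤ Fo.k := by exact_mod_cast hwk
  have hε' : 4 * (ε : ℤ) ≤ Fo.k := by exact_mod_cast hε
  obtain ⟨hz0, hz1, hz2⟩ := Fo.z_isIntJ
  have hmid : -(m : ℤ) + R₀ ≤ Fo.z 1 ∧ Fo.z 1 ≤ -(R₀ : ℤ) := Fo.z_mid
  obtain ⟨hm1, hm2⟩ := hmid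
  have hland := inTgtRow_mem_sepLanding ht
  -- the arc as a nonempty chain with prescribed crossings
  obtain ⟨E, L', hEL⟩ := List.exists_cons_of_ne_nil (List.ne_nil_of_mem hTe)
  have harc' : ∀ T ∈ E :: L', χ ∈ T.event := fun T hT => harc T (hEL ▸ hT)
  have hch : List.IsChain Crosses (E :: L') := hEL ▸ isChain_arc_thinRing hs hsr hsr' a len
  obtain ⟨X, Y, hXY⟩ := exists_crossings harc'
  have hTe' : Te ∈ E :: L' := hEL ▸ hTe
  have hring : ∀ T ∈ E :: L', T ∈ thinRing r e s := fun T hT => mem_of_mem_arc (hEL ▸ hT : T ∈ arc (thinRing r e s) a len)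
  have hLreg : ∀ T ∈ E :: L', T.box ⊆ triAnnulusSet n N := fun T hT v hv => by
    have := triNorm_mem_of_mem_thinRing he (hring T hT) hv
    rw [mem_triAnnulusSet]; constructor <;> omega
  -- the hook
  have hHA : haSet m ⊆ (frameIso i).symm '' (frameIso q '' armRegion m N zo) :=
    haSet_subset_image_frame_symm hi (triAnnSet_subset_frame_armRegion hq hmN zo)
  have P₁ := arm_to_entry hHA hi Fo hwk hk hwin hB hε hL hSp (hXY Te hTe') hJ
  rw [hb, RelIso.apply_symm_apply] at P₁
  -- everything lies in the arm region
  have hreg : frameIso i '' ((spokeTube m Fo.k T₀ w L ε).box ∪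
      ((frameIso i).symm '' (frameIso q '' armRegion m N zo) ∪ tipBox m (Fo.z 1) Fo.k)) ∪ Te.box ⊆
      genRegion n N q zo ![(n : ℤ), t] := by
    have hann : ∀ v : Site 2, (n : ℤ) ≤ triNorm v → triNorm v ≤ N → v ∈ genRegion n N q zo ![(n : ℤ), t] :=
      fun v h1 h2 => Or.inl (Or.inl ⟨h1, h2⟩)
    rintro v (⟨u, hu, rfl⟩ | hv)
    · rcases hu with hu | ⟨u', hu', rfl⟩ | hu
      · have := norm_mem_of_mem_spokeBox (R₀ := R₀) hwin ⟨hm1, hm2⟩ (by omega) (by omega) (by omega) hu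
        exact hann _ (by rw [triNorm_frameIso i hi]; omega) (by rw [triNorm_frameIso i hi]; omega)
      · rw [RelIso.apply_symm_apply]
        obtain ⟨u'', hu'', rfl⟩ := hu'
        rcases hu'' with hu'' | hu''
        · refine hann _ ?_ ?_
          · rw [show ((frameIso q : triGraph ≃g triGraph) u'') = frameIso q u'' from rfl, triNorm_frameIso q hq]
            exact (show (n : ℤ) ≤ m by omega).trans (mem_triAnnulusSet.1 hu'').1
          · rw [show ((frameIso q : triGraph ≃g triGraph) u'') = frameIso q u'' from rfl, triNorm_frameIso q hq]
            exact (mem_triAnnulusSet.1 hu'').2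
        · exact Or.inl (Or.inr ⟨u'', hu'', rfl⟩)
      · have := norm_mem_of_mem_tipBox' (by omega) (by omega) (by omega) hu
        exact hann _ (by rw [triNorm_frameIso i hi]; omega) (by rw [triNorm_frameIso i hi]; omega)
    · have := hLreg Te hTe' hv
      rw [mem_triAnnulusSet] at this
      exact hann v this.1 this.2
  -- glue
  exact landing_glue_gen hzo hOut hland hch hXY hLreg hreg hTe' P₁ (fun T hT => hEL ▸ hSL T hT) hlo hhi (by omega) hW hH hV hn
    (by omega)

/-! ### Landing on the top side `2`, by transposition -/

/-- **Landing glue towards the top side, outer end on the side `q`.** In a configuration `χ` whose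
outer end is landed on the side `q` (read in `frameConfig q χ`), let the attaching site
`frameIso q uo` be joined inside `R₁ ⊆ annulus ∪ frameIso q (landing ball)` to the start `X Te` of
the crossing of a tube `Te` of a chain `E :: L` of tubes all crossed by `χ`, inside the annulus,
containing the TRANSPOSES of the run `V_{j₀}, …, V_{j₀+d}` (pieces of the top side `x₁ = r` over the
columns `[t, t + n/64]`). If the transposed configuration `frameConfig 2 χ` crosses the approach tube
and the thinned target free space at the row `t`, then `frameConfig 2 χ ∈ sepArmGen n N q₂` for the
frame `q₂` with `frameIso q₂ = σ ∘ frameIso q`: `landing_glue_gen` in the transposed configuration. [cite: Nolin2008, §4.3 Prop. 12 (proof) (arXiv 0711.4948: Prop. 11)] -/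
theorem landing_glue_gen_two {n N q q₂ : ℕ} (hpt : ∀ v : Site 2, frameIso q₂ v = frameIso 2 (frameIso q v))
    {χ : SiteConfig (Site 2)} {zo uo : Site 2} (hzo : zo ∈ sepLanding N)
    (hOut : OpenVCrossThrough (sepOuterFence N zo) (zo 1 - (N / 64 : ℕ)) (zo 1 + (N / 64 : ℕ)) (frameConfig q χ) uo)
    {t : ℤ} (ht : (![(n : ℤ), t] : Site 2) ∈ sepLanding n)
    {E : Tube} {L : List Tube} (hch : List.IsChain Crosses (E :: L)) {X Y : Tube → Site 2}
    (hXY : ∀ T ∈ E :: L, T.IsCrossing χ (X T) (Y T)) (hLreg : ∀ T ∈ E :: L, T.box ⊆ triAnnulusSet n N)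
    {R₁ : Set (Site 2)} (hR₁ : R₁ ⊆ triAnnulusSet n N ∪ frameIso q '' triOpenBall zo (N / 8)) {Te : Tube} (hTe : Te ∈ E :: L)
    (P₁ : PathIn triGraph (R₁ ∩ χ) (frameIso q uo) (X Te))
    {r e s j₀ d : ℕ} (hSL : ∀ T ∈ vchunks r (-(r : ℤ)) e s j₀ (d + 1), T.swap ∈ E :: L)
    (hlo : -(r : ℤ) + j₀ * s - e ≤ t) (hhi : t + (n / 64 : ℕ) ≤ -(r : ℤ) + (j₀ + d) * s - e)
    (hre : (n : ℤ) ≤ (r : ℤ) - e) {W : ℕ} (hW : (n : ℤ) - (n / 8 : ℕ) + 1 + W = r + 2 * e)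
    (hH : frameConfig 2 χ ∈ tgtH n t W) (hV : frameConfig 2 χ ∈ tgtV n t) (hn : 64 ≤ n) (hrN : (r : ℤ) + 2 * e ≤ N) :
    frameConfig 2 χ ∈ sepArmGen n N q₂ := by
  -- frames
  have hcfg : frameConfig q₂ (frameConfig 2 χ) = frameConfig q χ := by
    ext v
    rw [mem_frameConfig, mem_frameConfig, mem_frameConfig, hpt, frameIso_two_two]
  -- the transposed chain and its crossings
  have hch' : List.IsChain Crosses (E.swap :: L.map swap) := by
    have := isChain_map_swap hch; simpa using this
  have hmem : ∀ T, T ∈ E.swap :: L.map swap ↔ T.swap ∈ E :: L := fun T => by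
    rw [List.mem_cons, List.mem_cons, mem_map_swap_iff]
    constructor
    · rintro (rfl | h)
      · left; exact swap_swap E
      · right; exact h
    · rintro (h | h)
      · left; rw [← h, swap_swap]
      · right; exact h
  have hXY' : ∀ T ∈ E.swap :: L.map swap, T.IsCrossing (frameConfig 2 χ) (frameIso 2 (X T.swap)) (frameIso 2 (Y T.swap)) := fun T hT => by
    have h := isCrossing_swap (hXY T.swap ((hmem T).1 hT))
    rw [swap_swap] at h
    exact h
  have hLreg' : ∀ T ∈ E.swap :: L.map swap, T.box ⊆ triAnnulusSet n N := fun T hT v hv => by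
    have hv' : frameIso 2 v ∈ T.swap.box := by rw [← swap_swap T, mem_box_swap] at hv; exact hv
    have := hLreg T.swap ((hmem T).1 hT) hv'
    rw [mem_triAnnulusSet, triNorm_frameIso 2 (by norm_num)] at this
    rw [mem_triAnnulusSet]; exact this
  -- the arm, transposed
  have P₁' : PathIn triGraph (((frameIso 2).symm '' R₁) ∩ frameConfig 2 χ) (frameIso q₂ uo) (frameIso 2 (X Te.swap.swap)) := by
    have hp' : PathIn triGraph (R₁ ∩ {v | v ∈ χ ↔ true}) (frameIso q uo) (X Te) := P₁.mono fun v hv => ⟨hv.1, by simpa using hv.2⟩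
    have q' := pathIn_frameConfig 2 hp'
    rw [frameIso_two_symm_apply, frameIso_two_symm_apply, ← hpt] at q'
    rw [swap_swap]
    exact q'.mono fun v hv => ⟨hv.1, hv.2.2 rfl⟩
  have hR₁' : (frameIso 2).symm '' R₁ ⊆ genRegion n N q₂ zo ![(n : ℤ), t] := by
    rintro w ⟨v, hv, rfl⟩
    rw [frameIso_two_symm_apply]
    rcases hR₁ hv with hv | ⟨u, hu, rfl⟩
    · refine Or.inl (Or.inl ?_)
      rw [mem_triAnnulusSet, triNorm_frameIso 2 (by norm_num)]; exact mem_triAnnulusSet.1 hv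
    · refine Or.inl (Or.inr ⟨u, hu, ?_⟩)
      rw [show ((frameIso q : triGraph ≃g triGraph) u) = frameIso q u from rfl, ← hpt]
  have hTe' : Te.swap ∈ E.swap :: L.map swap := (hmem _).2 (by rw [swap_swap]; exact hTe)
  have hSL' : ∀ T ∈ vchunks r (-(r : ℤ)) e s j₀ (d + 1), T ∈ E.swap :: L.map swap := fun T hT => (hmem T).2 (hSL T hT)
  have hOut' : OpenVCrossThrough (sepOuterFence N zo) (zo 1 - (N / 64 : ℕ)) (zo 1 + (N / 64 : ℕ)) (frameConfig q₂ (frameConfig 2 χ)) uo := by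
    rw [hcfg]; exact hOut
  exact landing_glue_gen (χ := frameConfig 2 χ) hzo hOut' ht hch' (X := fun T => frameIso 2 (X T.swap)) (Y := fun T => frameIso 2 (Y T.swap))
    hXY' hLreg' hR₁' hTe' P₁' hSL' hlo hhi hre hW hH hV hn hrN

/-- **The inner landing move to the top side `2` at an arbitrary middle target column, outer end
on the side `q`.** As `landing_move_gen` up to the ring, then the TRANSPOSED exit run, approach tube
and target free space; conclusion `frameConfig 2 χ ∈ sepArmGen n N q₂` (`frameIso q₂ = σ ∘ frameIso q`). [cite: Nolin2008, §4.3 Prop. 12 and §4.4 (arXiv 0711.4948: Prop. 11, Thm. 10, p. 13)] -/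
theorem landing_move_gen_two {m n N k₀ K R₀ q q₂ : ℕ} (hq : q < 6) (hpt : ∀ v : Site 2, frameIso q₂ v = frameIso 2 (frameIso q v))
    {i : ℕ} (hi : i < 6) {χ : SiteConfig (Site 2)} {zo uo : Site 2}
    (hzo : zo ∈ sepLanding N)
    (hOut : OpenVCrossThrough (sepOuterFence N zo) (zo 1 - (N / 64 : ℕ)) (zo 1 + (N / 64 : ℕ)) (frameConfig q χ) uo)
    (Fo : IntFencedArm m ((frameIso i).symm '' (frameIso q '' armRegion m N zo)) k₀ K R₀ (frameConfig i χ))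
    (hb : Fo.b = (frameIso i).symm (frameIso q uo))
    {T₀ : ℤ} {w : ℕ} (hwk : 4 * w ≤ Fo.k) (hk : 4 ≤ Fo.k) (hwin : T₀ ≤ Fo.z 1 ∧ Fo.z 1 < T₀ + w)
    (hB : frameConfig i χ ∈ triFrameAt (bcnCentre m Fo.k T₀ w) (Fo.k / 2))
    {L ε : ℕ} (hε : 4 * ε ≤ Fo.k) (hL : 2 * Fo.k ≤ L) (hSp : χ ∈ spokeEvent i m Fo.k T₀ w L ε)
    {r e s a len : ℕ} (hs : 1 ≤ s) (hsr : s ∣ r) (hsr' : s ≤ r) (he : 2 * e ≤ r)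
    (harc : χ ∈ eventAll (arc (thinRing r e s) a len))
    {Te : Tube} (hTe : Te ∈ arc (thinRing r e s) a len) (hJ : SpokeMeets i (spokeTube m Fo.k T₀ w L ε) Te)
    {t : ℤ} (ht : -(n : ℤ) + (n / 4 : ℕ) + (n / 16 : ℕ) ≤ t ∧ t ≤ -((n / 4 : ℕ) : ℤ) - (n / 16 : ℕ))
    {j₀ d : ℕ} (hSL : ∀ T ∈ vchunks r (-(r : ℤ)) e s j₀ (d + 1), T.swap ∈ arc (thinRing r e s) a len)
    (hlo : -(r : ℤ) + j₀ * s - e ≤ t) (hhi : t + (n / 64 : ℕ) ≤ -(r : ℤ) + (j₀ + d) * s - e)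
    {W : ℕ} (hW : (n : ℤ) - (n / 8 : ℕ) + 1 + W = r + 2 * e) (hH : frameConfig 2 χ ∈ tgtH n t W)
    (hV : frameConfig 2 χ ∈ tgtV n t)
    (hn : 64 ≤ n) (hnr : (n : ℤ) + s + 2 * e ≤ r) (hrm : (r : ℤ) + 2 * e ≤ m) (hmN : 2 * m ≤ N)
    (hnL : (n : ℤ) + 2 * Fo.k + L ≤ m + 1) (hn5 : (n : ℤ) + 5 * Fo.k ≤ m) (hR : 4 * Fo.k ≤ R₀) :
    frameConfig 2 χ ∈ sepArmGen n N q₂ := by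
  have hmN' : 2 * (m : ℤ) ≤ N := by exact_mod_cast hmN
  have hR' : 4 * (Fo.k : ℤ) ≤ R₀ := by exact_mod_cast hR
  have hwk' : 4 * (w : ℤ) ≤ Fo.k := by exact_mod_cast hwk
  have hε' : 4 * (ε : ℤ) ≤ Fo.k := by exact_mod_cast hε
  obtain ⟨hz0, hz1, hz2⟩ := Fo.z_isIntJ
  have hmid : -(m : ℤ) + R₀ ≤ Fo.z 1 ∧ Fo.z 1 ≤ -(R₀ : ℤ) := Fo.z_mid
  obtain ⟨hm1, hm2⟩ := hmid
  have hland := inTgtRow_mem_sepLanding ht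
  -- the arc as a nonempty chain with prescribed crossings
  obtain ⟨E, L', hEL⟩ := List.exists_cons_of_ne_nil (List.ne_nil_of_mem hTe)
  have harc' : ∀ T ∈ E :: L', χ ∈ T.event := fun T hT => harc T (hEL ▸ hT)
  have hch : List.IsChain Crosses (E :: L') := hEL ▸ isChain_arc_thinRing hs hsr hsr' a len
  obtain ⟨X, Y, hXY⟩ := exists_crossings harc'
  have hTe' : Te ∈ E :: L' := hEL ▸ hTe
  have hring : ∀ T ∈ E :: L', T ∈ thinRing r e s := fun T hT => mem_of_mem_arc (hEL ▸ hT : T ∈ arc (thinRing r e s) a len)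
  have hLreg : ∀ T ∈ E :: L', T.box ⊆ triAnnulusSet n N := fun T hT v hv => by
    have := triNorm_mem_of_mem_thinRing he (hring T hT) hv
    rw [mem_triAnnulusSet]; constructor <;> omega
  -- the hook
  have hHA : haSet m ⊆ (frameIso i).symm '' (frameIso q '' armRegion m N zo) :=
    haSet_subset_image_frame_symm hi (triAnnSet_subset_frame_armRegion hq hmN zo)
  have P₁ := arm_to_entry hHA hi Fo hwk hk hwin hB hε hL hSp (hXY Te hTe') hJ
  rw [hb, RelIso.apply_symm_apply] at P₁
  -- everything lies in the annulus or the outer landing ball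
  have hreg : frameIso i '' ((spokeTube m Fo.k T₀ w L ε).box ∪
      ((frameIso i).symm '' (frameIso q '' armRegion m N zo) ∪ tipBox m (Fo.z 1) Fo.k)) ∪ Te.box ⊆
      triAnnulusSet n N ∪ frameIso q '' triOpenBall zo (N / 8) := by
    have hann : ∀ v : Site 2, (n : ℤ) ≤ triNorm v → triNorm v ≤ N → v ∈ triAnnulusSet n N ∪ frameIso q '' triOpenBall zo (N / 8) :=
      fun v h1 h2 => Or.inl ⟨h1, h2⟩
    rintro v (⟨u, hu, rfl⟩ | hv)
    · rcases hu with hu | ⟨u', hu', rfl⟩ | hu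
      · have := norm_mem_of_mem_spokeBox (R₀ := R₀) hwin ⟨hm1, hm2⟩ (by omega) (by omega) (by omega) hu
        exact hann _ (by rw [triNorm_frameIso i hi]; omega) (by rw [triNorm_frameIso i hi]; omega)
      · rw [RelIso.apply_symm_apply]
        obtain ⟨u'', hu'', rfl⟩ := hu'
        rcases hu'' with hu'' | hu''
        · refine hann _ ?_ ?_
          · rw [show ((frameIso q : triGraph ≃g triGraph) u'') = frameIso q u'' from rfl, triNorm_frameIso q hq]
            exact (show (n : ℤ) ≤ m by omega).trans (mem_triAnnulusSet.1 hu'').1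
          · rw [show ((frameIso q : triGraph ≃g triGraph) u'') = frameIso q u'' from rfl, triNorm_frameIso q hq]
            exact (mem_triAnnulusSet.1 hu'').2
        · exact Or.inr ⟨u'', hu'', rfl⟩
      · have := norm_mem_of_mem_tipBox' (by omega) (by omega) (by omega) hu
        exact hann _ (by rw [triNorm_frameIso i hi]; omega) (by rw [triNorm_frameIso i hi]; omega)
    · have := hLreg Te hTe' hv
      rw [mem_triAnnulusSet] at this
      exact hann v this.1 this.2
  -- glue, transposed
  exact landing_glue_gen_two hpt hzo hOut hland hch hXY hLreg hreg hTe' P₁ (fun T hT => hEL ▸ hSL T hT) hlo hhi (by omega) hW hH hV hn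
    (by omega)

/-- The frames `q₂` with `frameIso q₂ = σ ∘ frameIso q` for the box-preserving sides:
`(q, q₂) = (0, 2), (2, 0), (3, 5), (5, 3)`. [folklore] -/
theorem frameIso_swap_comp (v : Site 2) :
    frameIso 2 v = frameIso 2 (frameIso 0 v) ∧ frameIso 0 v = frameIso 2 (frameIso 2 v) ∧
      frameIso 5 v = frameIso 2 (frameIso 3 v) ∧ frameIso 3 v = frameIso 2 (frameIso 5 v) := by
  obtain ⟨a0, a1, -, -, b0, b1, c0, c1, -, -, d0, d1⟩ := frameIso_apply_formula v
  obtain ⟨-, -, -, -, e0, e1, -⟩ := frameIso_apply_formula (frameIso 3 v)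
  obtain ⟨-, -, -, -, f0, f1, -⟩ := frameIso_apply_formula (frameIso 5 v)
  refine ⟨rfl, (frameIso_two_two v).symm, Site.eq_iff_two.2 ⟨by rw [d0, e0, c1], by rw [d1, e1, c0]⟩,
    Site.eq_iff_two.2 ⟨by rw [c0, f0, d1], by rw [c1, f1, d0]⟩⟩

end Literature.Probability.Percolation
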